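import Summits.Ventures.HodgeRepro2.T5SU11JacobiWeightAsymptotic
import Summits.Ventures.HodgeRepro2.T5SU11JacobiWeight

/-!
# The decay ratio of the Jacobi transform in the weight tends to `1`

For fixed `λ` and `h ≥ 0` the decay ratio `m̂_{k+h}(λ)/m̂_k(λ)` of the Jacobi transform lies in `(0, 1]`
(`jacobi_ratio_pos`, `jacobi_ratio_le_one`; `< 1` for `h > 0`, `jacobi_ratio_lt_one` — the antitonicity of
`T5SU11JacobiWeight`) and **tends to `1` as `k → ∞`** (`tendsto_jacobi_ratio_atTop_one`): by
`k · m̂_k(λ) → 2π` (`T5SU11JacobiWeightAsymptotic.tendsto_mul_jacobi_weight`),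

  `m̂_{k+h}/m̂_k = ((k + h) m̂_{k+h})/(k m̂_k) · k/(k + h) → (2π/2π) · 1 = 1`.

Together with the monotonicity of the ratio in `k` (`T5SU11JacobiCompleteMonotonePhase.jacobi_ratio_le`,
not imported here) the ratio INCREASES TO `1`: the transform is slowly varying in the weight, the
Laplace-transform counterpart of `m̂_k(λ) ∼ 2π/k`. Nothing is claimed about (N).

Blind lane: Mathlib + the HodgeRepro2 prefix only; no sorry; axioms ⊆ {propext, Classical.choice,
Quot.sound}.
-/

namespace Summit.Ventures.HodgeRepro2.T5SU11JacobiRatioLimit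

open MeasureTheory MeasureTheory.Measure Metric Set Filter Topology
open T5SU11Unimodular T5SU11Fibration T5SU11Cartan T5HaarCircle T5BergmanCoefficient
  T5SU11FibrationHaar T5SU11SphericalFunction T5SU11SphericalSymmetry T5SU11SphericalBounds
  T5SU11SphericalContinuous T5SU11JacobiIwasawa T5SU11JacobiTransform T5SU11JacobiWeight
  T5SU11KFiniteMajorantPow T5SU11JacobiWeightAsymptotic
open scoped Real

/-- `k/(k + h) → 1` as `k → ∞`. -/
theorem tendsto_div_add_const_atTop_one (h : ℝ) :
    Tendsto (fun k : ℝ => k / (k + h)) atTop (𝓝 1) := by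
  have h0 : Tendsto (fun k : ℝ => h / (k + h)) atTop (𝓝 0) :=
    (tendsto_atTop_add_const_right atTop h tendsto_id).const_div_atTop h
  have h1 : Tendsto (fun k : ℝ => 1 - h / (k + h)) atTop (𝓝 (1 - 0)) := tendsto_const_nhds.sub h0
  rw [sub_zero] at h1
  refine h1.congr' ?_
  filter_upwards [eventually_gt_atTop (max 0 (-h))] with k hk
  rw [max_lt_iff] at hk
  have : k + h ≠ 0 := by linarith
  field_simp
  ring

section measure

variable [MeasurableSpace Circle] [BorelSpace Circle]

/-- The decay ratio is positive on the ray. -/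
theorem jacobi_ratio_pos {k lam : ℝ} (hk : 1 < k) (h1 : lam < k) (h2 : 2 < k + lam) {h : ℝ}
    (hh : 0 ≤ h) :
    0 < (∫ g, (1 - ‖orbit g‖ ^ 2) ^ ((k + h) / 2) * sph lam g ∂(nu haarCircle))
        / ∫ g, (1 - ‖orbit g‖ ^ 2) ^ (k / 2) * sph lam g ∂(nu haarCircle) :=
  div_pos (jacobi_pos (by linarith) (by linarith) (by linarith)) (jacobi_pos hk h1 h2)

/-- The decay ratio is `≤ 1` for `h ≥ 0` (antitonicity in the weight). -/
theorem jacobi_ratio_le_one {k lam : ℝ} (hk : 1 < k) (h1 : lam < k) (h2 : 2 < k + lam) {h : ℝ}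
    (hh : 0 ≤ h) :
    (∫ g, (1 - ‖orbit g‖ ^ 2) ^ ((k + h) / 2) * sph lam g ∂(nu haarCircle))
        / ∫ g, (1 - ‖orbit g‖ ^ 2) ^ (k / 2) * sph lam g ∂(nu haarCircle) ≤ 1 :=
  (div_le_one (jacobi_pos hk h1 h2)).mpr (jacobi_weight_le hk h1 h2 (by linarith))

/-- The decay ratio is `< 1` for `h > 0` (strict antitonicity in the weight). -/
theorem jacobi_ratio_lt_one {k lam : ℝ} (hk : 1 < k) (h1 : lam < k) (h2 : 2 < k + lam) {h : ℝ}
    (hh : 0 < h) :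
    (∫ g, (1 - ‖orbit g‖ ^ 2) ^ ((k + h) / 2) * sph lam g ∂(nu haarCircle))
        / ∫ g, (1 - ‖orbit g‖ ^ 2) ^ (k / 2) * sph lam g ∂(nu haarCircle) < 1 :=
  (div_lt_one (jacobi_pos hk h1 h2)).mpr (jacobi_weight_lt hk h1 h2 (by linarith))

/-- `(k + h) · m̂_{k+h}(λ) → 2π` as `k → ∞` (the shift of `tendsto_mul_jacobi_weight`). -/
theorem tendsto_add_mul_jacobi_weight (lam h : ℝ) :
    Tendsto (fun k : ℝ => (k + h) * ∫ g, (1 - ‖orbit g‖ ^ 2) ^ ((k + h) / 2) * sph lam g ∂(nu haarCircle))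
      atTop (𝓝 (2 * π)) :=
  (tendsto_mul_jacobi_weight lam).comp (tendsto_atTop_add_const_right atTop h tendsto_id)

/-- **THE DECAY RATIO TENDS TO `1`**: for every `λ` and `h`,
`m̂_{k+h}(λ)/m̂_k(λ) → 1` as `k → ∞`. -/
theorem tendsto_jacobi_ratio_atTop_one (lam h : ℝ) :
    Tendsto (fun k : ℝ => (∫ g, (1 - ‖orbit g‖ ^ 2) ^ ((k + h) / 2) * sph lam g ∂(nu haarCircle))
        / ∫ g, (1 - ‖orbit g‖ ^ 2) ^ (k / 2) * sph lam g ∂(nu haarCircle)) atTop (𝓝 1) := by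
  have hpi : (2 * π : ℝ) ≠ 0 := by positivity
  have hA : Tendsto (fun k : ℝ =>
      ((k + h) * ∫ g, (1 - ‖orbit g‖ ^ 2) ^ ((k + h) / 2) * sph lam g ∂(nu haarCircle))
        / (k * ∫ g, (1 - ‖orbit g‖ ^ 2) ^ (k / 2) * sph lam g ∂(nu haarCircle)))
      atTop (𝓝 (2 * π / (2 * π))) :=
    (tendsto_add_mul_jacobi_weight lam h).div (tendsto_mul_jacobi_weight lam) hpi
  rw [div_self hpi] at hA
  have hB := hA.mul (tendsto_div_add_const_atTop_one h)
  rw [mul_one] at hB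
  refine hB.congr' ?_
  filter_upwards [eventually_gt_atTop (max 0 (-h))] with k hk
  rw [max_lt_iff] at hk
  have hk0 : k ≠ 0 := by linarith
  have hkh : k + h ≠ 0 := by linarith
  field_simp

end measure

end Summit.Ventures.HodgeRepro2.T5SU11JacobiRatioLimit
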